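import Summits.QuantumFields.GaugeBoot.Certificates.SparseReduced
import HarnessLib

/-!
# Sparse certificate replay, part 4: position lists, trace tables and the assembled bound for reduced blocks

HONEST FRAMING (cell `pub-gaugeboot`): certified bounds on lattice expectations at stated coupling,
gauge group, dimension and torus size; NOT a mass gap, NOT a continuum limit, NOT a string tension;
NOT Yang–Mills-summit-bearing (barriers `FixedCouplingUltralocality`, `PerturbativeInvisibility`).

Sequel of `Certificates/SparseReduced.lean` (emitter `gb_lean_emit` 0.8 "reduced", FANOUT-PLAN
A27 / A126 (2)): two-level per-variable position lists `getP` (triples `(k, i, j)` = block, row,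
column), their shape / sortedness check (`shapeCheck` ⇒ in range and duplicate-free) and cover
check (`entCoverCheck`: every term of every block entry is listed under its variable), the
per-certificate trace-table check `traceCheck` (`T[v] = Σ_{(k,i,j) ∈ P[v]} coef · (G_k G_kᵀ)_{ij}`),
the summed trace identity `sum_trace_zr_mul_fzE : Σ_k tr (Z_k/4^K · F⁽ᵏ⁾_v) = T[v] / 4^K`, and the
assembled abstract bound `objective_bound_red` (→ `objective_bound₂` →
`JanssonChaykinKeil.lmiForm_bound`, Jansson–Chaykin–Keil 2007).  Every kernel-side quantity is a
structural `List` recursion checked by `decide +kernel` over index ranges.  All `[folklore]`.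
-/

namespace Summit.QuantumFields.GaugeBoot.Certificates.Sparse

open Matrix Finset Literature.Computation.Certificates

noncomputable section

/-! ## Position lists: shape, sortedness, cover -/

/-- Two-level per-variable position lists: `P[v] = P2[v / B][v % B]`, a list of triples
`(k, i, j)` = (block, row, column). [folklore] -/
def getP (P2 : List (List (List (ℕ × ℕ × ℕ)))) (B v : ℕ) : List (ℕ × ℕ × ℕ) :=
  (P2.getD (v / B) []).getD (v % B) []

/-- Code of a triple for the sortedness check. [folklore] -/
def tcode (m : ℕ) (q : ℕ × ℕ × ℕ) : ℕ := (q.1 * m + q.2.1) * m + q.2.2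

/-- Strictly increasing list of naturals. [folklore] -/
def incr : List ℕ → Bool
  | [] => true
  | [_] => true
  | a :: b :: rest => decide (a < b) && incr (b :: rest)

/-- Tail of an increasing list is increasing. [folklore] -/
theorem incr_tail {a : ℕ} {l : List ℕ} (h : incr (a :: l) = true) : incr l = true := by
  cases l with
  | nil => rfl
  | cons b _ => simp only [incr, Bool.and_eq_true] at h; exact h.2

/-- The head of an increasing list is below every later element. [folklore] -/
theorem lt_of_incr : ∀ {a : ℕ} {l : List ℕ}, incr (a :: l) = true → ∀ x ∈ l, a < x
  | _, [], _, x, hx => absurd hx List.not_mem_nil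
  | a, b :: rest, h, x, hx => by
      simp only [incr, Bool.and_eq_true, decide_eq_true_eq] at h
      rcases List.mem_cons.mp hx with rfl | hx'
      · exact h.1
      · exact lt_trans h.1 (lt_of_incr h.2 x hx')

/-- An increasing list has no duplicates. [folklore] -/
theorem nodup_of_incr : ∀ {l : List ℕ}, incr l = true → l.Nodup
  | [], _ => List.nodup_nil
  | a :: _, h =>
      List.nodup_cons.mpr ⟨fun hm => lt_irrefl a (lt_of_incr h a hm), nodup_of_incr (incr_tail h)⟩

/-- Shape check for the variables `lo ≤ v < hi`: every triple of `P[v]` is in range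
(`k < nb`, `i, j < m`) and the codes increase strictly (⇒ duplicate-free). [folklore] -/
def shapeCheck (P2 : List (List (List (ℕ × ℕ × ℕ)))) (B nb m lo hi : ℕ) : Bool :=
  natAll (hi - lo) fun t =>
    ((getP P2 B (lo + t)).all fun q => decide (q.1 < nb) && decide (q.2.1 < m) && decide (q.2.2 < m))
      && incr ((getP P2 B (lo + t)).map (tcode m))

/-- What `shapeCheck` establishes. [folklore] -/
def ShapeOK (P2 : List (List (List (ℕ × ℕ × ℕ)))) (B nb m lo hi : ℕ) : Prop :=
  ∀ v, lo ≤ v → v < hi →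
    (∀ q ∈ getP P2 B v, q.1 < nb ∧ q.2.1 < m ∧ q.2.2 < m) ∧ (getP P2 B v).Nodup

/-- Soundness of `shapeCheck`. [folklore] -/
theorem shapeOK_of_check {P2 : List (List (List (ℕ × ℕ × ℕ)))} {B nb m lo hi : ℕ}
    (h : shapeCheck P2 B nb m lo hi = true) : ShapeOK P2 B nb m lo hi := by
  intro v hlo hhi
  have hv := natAll_iff.mp h (v - lo) (by omega)
  rw [show lo + (v - lo) = v by omega] at hv
  simp only [Bool.and_eq_true, List.all_eq_true, decide_eq_true_eq] at hv
  exact ⟨fun q hq => ⟨(hv.1 q hq).1.1, (hv.1 q hq).1.2, (hv.1 q hq).2⟩,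
    List.Nodup.of_map _ (nodup_of_incr hv.2)⟩

/-- Concatenating variable ranges. [folklore] -/
theorem ShapeOK.append {P2 : List (List (List (ℕ × ℕ × ℕ)))} {B nb m lo mid hi : ℕ}
    (h1 : ShapeOK P2 B nb m lo mid) (h2 : ShapeOK P2 B nb m mid hi) : ShapeOK P2 B nb m lo hi :=
  fun v hlo hhi => if hm : v < mid then h1 v hlo hm else h2 v (Nat.le_of_not_lt hm) hhi

/-- Boolean list membership of a triple of naturals. [folklore] -/
def memTriple (k i j : ℕ) : List (ℕ × ℕ × ℕ) → Bool
  | [] => false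
  | q :: qs => (k == q.1 && i == q.2.1 && j == q.2.2) || memTriple k i j qs

/-- Specification of `memTriple`. [folklore] -/
theorem memTriple_iff {k i j : ℕ} : ∀ {l : List (ℕ × ℕ × ℕ)}, memTriple k i j l = true ↔ (k, i, j) ∈ l
  | [] => by simp [memTriple]
  | (q1, q2, q3) :: qs => by simp [memTriple, memTriple_iff (l := qs), and_assoc]

/-- Cover check for the blocks `klo ≤ k < khi`: for every entry position `(i, j)`, `i, j < m`,
every term `(w, c)` of the (transposed) entry `ent k j i` has `(k, i, j)` listed in `P[w]`.
[folklore] -/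
def entCoverCheck (EB : List (List (List (List (ℕ × ℤ))))) (P2 : List (List (List (ℕ × ℕ × ℕ))))
    (B m klo khi : ℕ) : Bool :=
  natAll (khi - klo) fun t => natAll m fun i => natAll m fun j =>
    (ent EB (klo + t) j i).all fun p => memTriple (klo + t) i j (getP P2 B p.1)

/-- What `entCoverCheck` establishes. [folklore] -/
def EntCoverOK (EB : List (List (List (List (ℕ × ℤ))))) (P2 : List (List (List (ℕ × ℕ × ℕ))))
    (B m klo khi : ℕ) : Prop :=
  ∀ k, klo ≤ k → k < khi → ∀ i < m, ∀ j < m, ∀ p ∈ ent EB k j i, (k, i, j) ∈ getP P2 B p.1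

/-- Soundness of `entCoverCheck`. [folklore] -/
theorem entCoverOK_of_check {EB : List (List (List (List (ℕ × ℤ))))}
    {P2 : List (List (List (ℕ × ℕ × ℕ)))} {B m klo khi : ℕ}
    (h : entCoverCheck EB P2 B m klo khi = true) : EntCoverOK EB P2 B m klo khi := by
  intro k hlo hhi i hi j hj p hp
  have h1 := natAll_iff.mp (natAll_iff.mp (natAll_iff.mp h (k - klo) (by omega)) i hi) j hj
  rw [show klo + (k - klo) = k by omega] at h1
  exact memTriple_iff.mp (List.all_eq_true.mp h1 p hp)

/-- Concatenating block ranges. [folklore] -/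
theorem EntCoverOK.append {EB : List (List (List (List (ℕ × ℤ))))}
    {P2 : List (List (List (ℕ × ℕ × ℕ)))} {B m klo kmid khi : ℕ}
    (h1 : EntCoverOK EB P2 B m klo kmid) (h2 : EntCoverOK EB P2 B m kmid khi) :
    EntCoverOK EB P2 B m klo khi :=
  fun k hlo hhi => if hm : k < kmid then h1 k hlo hm else h2 k (Nat.le_of_not_lt hm) hhi

/-! ## Per-certificate trace tables -/

/-- The summand of position `q = (k, i, j)` for variable `v`:
`coef (ent k j i) v · ⟨G_k[i], G_k[j]⟩`. [folklore] -/
def posTerm (GB : List (List (List ℤ))) (EB : List (List (List (List (ℕ × ℤ))))) (v : ℕ)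
    (q : ℕ × ℕ × ℕ) : ℤ :=
  coef (ent EB q.1 q.2.2 q.2.1) v *
    listDot ((GB.getD q.1 []).getD q.2.1 []) ((GB.getD q.1 []).getD q.2.2 [])

/-- Weighted position sum `Σ_{q ∈ l} posTerm q` (structural recursion). [folklore] -/
def posSumW (GB : List (List (List ℤ))) (EB : List (List (List (List (ℕ × ℤ))))) (v : ℕ) :
    List (ℕ × ℕ × ℕ) → ℤ
  | [] => 0
  | q :: qs => posTerm GB EB v q + posSumW GB EB v qs

/-- `posSumW` as a mapped list sum. [folklore] -/
theorem posSumW_eq_sum_map (GB : List (List (List ℤ))) (EB : List (List (List (List (ℕ × ℤ)))))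
    (v : ℕ) : ∀ l : List (ℕ × ℕ × ℕ), posSumW GB EB v l = (l.map (posTerm GB EB v)).sum
  | [] => rfl
  | q :: qs => by simp [posSumW, posSumW_eq_sum_map GB EB v qs]

/-- Trace-table check for the variables `lo ≤ v < hi`: `T[v] = posSumW … (P[v])`. [folklore] -/
def traceCheck (GB : List (List (List ℤ))) (EB : List (List (List (List (ℕ × ℤ)))))
    (P2 : List (List (List (ℕ × ℕ × ℕ)))) (B : ℕ) (T : List ℤ) (lo hi : ℕ) : Bool :=
  natAll (hi - lo) fun t => posSumW GB EB (lo + t) (getP P2 B (lo + t)) == T.getD (lo + t) 0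

/-- What `traceCheck` establishes. [folklore] -/
def TraceOK (GB : List (List (List ℤ))) (EB : List (List (List (List (ℕ × ℤ)))))
    (P2 : List (List (List (ℕ × ℕ × ℕ)))) (B : ℕ) (T : List ℤ) (lo hi : ℕ) : Prop :=
  ∀ v, lo ≤ v → v < hi → posSumW GB EB v (getP P2 B v) = T.getD v 0

/-- Soundness of `traceCheck`. [folklore] -/
theorem traceOK_of_check {GB : List (List (List ℤ))} {EB : List (List (List (List (ℕ × ℤ))))}
    {P2 : List (List (List (ℕ × ℕ × ℕ)))} {B : ℕ} {T : List ℤ} {lo hi : ℕ}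
    (h : traceCheck GB EB P2 B T lo hi = true) : TraceOK GB EB P2 B T lo hi := by
  intro v hlo hhi
  have hv := natAll_iff.mp h (v - lo) (by omega)
  rw [show lo + (v - lo) = v by omega] at hv
  exact beq_iff_eq.mp hv

/-- Concatenating variable ranges. [folklore] -/
theorem TraceOK.append {GB : List (List (List ℤ))} {EB : List (List (List (List (ℕ × ℤ))))}
    {P2 : List (List (List (ℕ × ℕ × ℕ)))} {B : ℕ} {T : List ℤ} {lo mid hi : ℕ}
    (h1 : TraceOK GB EB P2 B T lo mid) (h2 : TraceOK GB EB P2 B T mid hi) :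
    TraceOK GB EB P2 B T lo hi :=
  fun v hlo hhi => if hm : v < mid then h1 v hlo hm else h2 v (Nat.le_of_not_lt hm) hhi

/-! ## The summed trace identity -/

/-- Integer core: the sum of `posTerm` over ALL positions `(k, i, j)`, `k < nb`, `i, j < m`,
equals the table entry `T[v]` (cover ⇒ unlisted positions vanish; shape ⇒ listed positions are
in range and duplicate-free). [folklore] -/
theorem sum_posTerm_eq {GB : List (List (List ℤ))} {EB : List (List (List (List (ℕ × ℤ))))}
    {P2 : List (List (List (ℕ × ℕ × ℕ)))} {B nb m nv : ℕ} {T : List ℤ}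
    (hshape : ShapeOK P2 B nb m 0 nv) (hcov : EntCoverOK EB P2 B m 0 nb)
    (htr : TraceOK GB EB P2 B T 0 nv) {v : ℕ} (hv : v < nv) :
    ∑ k : Fin nb, ∑ i : Fin m, ∑ j : Fin m, posTerm GB EB v (k.val, i.val, j.val) = T.getD v 0 := by
  classical
  obtain ⟨hrange, hnd⟩ := hshape v (Nat.zero_le _) hv
  let e : Fin nb × Fin m × Fin m ↪ ℕ × ℕ × ℕ :=
    ⟨fun x => (x.1.val, x.2.1.val, x.2.2.val), fun x x' hx => by
      simp only [Prod.mk.injEq] at hx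
      exact Prod.ext (Fin.ext hx.1) (Prod.ext (Fin.ext hx.2.1) (Fin.ext hx.2.2))⟩
  have hsub : (getP P2 B v).toFinset ⊆ (Finset.univ : Finset (Fin nb × Fin m × Fin m)).map e := by
    intro q hq
    rw [List.mem_toFinset] at hq
    obtain ⟨h1, h2, h3⟩ := hrange q hq
    exact Finset.mem_map.mpr ⟨(⟨q.1, h1⟩, ⟨q.2.1, h2⟩, ⟨q.2.2, h3⟩), Finset.mem_univ _, rfl⟩
  have hzero : ∀ q ∈ (Finset.univ : Finset (Fin nb × Fin m × Fin m)).map e,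
      q ∉ (getP P2 B v).toFinset → posTerm GB EB v q = 0 := by
    intro q hq hnot
    obtain ⟨x, -, rfl⟩ := Finset.mem_map.mp hq
    by_contra hne
    have hc : coef (ent EB x.1.val x.2.2.val x.2.1.val) v ≠ 0 := fun h0 => hne (by simp [posTerm, e, h0])
    obtain ⟨c, hc'⟩ := exists_mem_of_coef_ne_zero hc
    have hmem := hcov x.1.val (Nat.zero_le _) x.1.isLt x.2.1.val x.2.1.isLt x.2.2.val x.2.2.isLt
      (v, c) hc'
    exact hnot (List.mem_toFinset.mpr hmem)
  have hinner : ∀ k : Fin nb, ∑ i : Fin m, ∑ j : Fin m, posTerm GB EB v (k.val, i.val, j.val) =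
      ∑ p : Fin m × Fin m, posTerm GB EB v (k.val, p.1.val, p.2.val) := fun k => by
    rw [← Fintype.sum_prod_type']
  calc ∑ k : Fin nb, ∑ i : Fin m, ∑ j : Fin m, posTerm GB EB v (k.val, i.val, j.val)
      = ∑ k : Fin nb, ∑ p : Fin m × Fin m, posTerm GB EB v (k.val, p.1.val, p.2.val) :=
        Finset.sum_congr rfl fun k _ => hinner k
    _ = ∑ x : Fin nb × Fin m × Fin m, posTerm GB EB v (x.1.val, x.2.1.val, x.2.2.val) := by
        rw [← Fintype.sum_prod_type']
    _ = ∑ q ∈ (Finset.univ : Finset (Fin nb × Fin m × Fin m)).map e, posTerm GB EB v q := by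
        rw [Finset.sum_map]
        rfl
    _ = ∑ q ∈ (getP P2 B v).toFinset, posTerm GB EB v q := (Finset.sum_subset hsub hzero).symm
    _ = ((getP P2 B v).map (posTerm GB EB v)).sum := List.sum_toFinset _ hnd
    _ = T.getD v 0 := by rw [← posSumW_eq_sum_map]; exact htr v (Nat.zero_le _) hv

/-- **Summed trace identity**: `Σ_k tr (Z_k/4^K · F⁽ᵏ⁾_v) = T[v] / 4^K` with the Gram duals
`Z_k = G_k G_kᵀ` read from the factor rows and all blocks padded to `m × m`. [folklore] -/
theorem sum_trace_zr_mul_fzE {GB : List (List (List ℤ))} {EB : List (List (List (List (ℕ × ℤ))))}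
    {P2 : List (List (List (ℕ × ℕ × ℕ)))} {B nb m nv : ℕ} {T : List ℤ} (K : ℕ)
    (hshape : ShapeOK P2 B nb m 0 nv) (hcov : EntCoverOK EB P2 B m 0 nb)
    (htr : TraceOK GB EB P2 B T 0 nv) (v : Fin nv) :
    ∑ k : Fin nb, trace (zr (GB.getD k.val []) m K * (fzE EB k.val m v.val).map (Int.cast : ℤ → ℝ)) =
      ((T.getD v.val 0 : ℤ) : ℝ) / 4 ^ K := by
  have hterm : ∀ (k : Fin nb) (i j : Fin m),
      zr (GB.getD k.val []) m K i j * ((fzE EB k.val m v.val).map (Int.cast : ℤ → ℝ)) j i =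
        ((posTerm GB EB v.val (k.val, i.val, j.val) : ℤ) : ℝ) / 4 ^ K := by
    intro k i j
    simp only [zr, zmat, fzE, posTerm, Matrix.smul_apply, Matrix.map_apply, Matrix.of_apply,
      smul_eq_mul]
    push_cast
    ring
  simp only [Matrix.trace, Matrix.diag_apply, Matrix.mul_apply, hterm]
  rw [← sum_posTerm_eq hshape hcov htr v.isLt]
  push_cast
  simp only [Finset.sum_div]

/-- The trace term of a single table `[(K, T)]`, cast to `ℝ`. [folklore] -/
theorem traceTerm_single (K : ℕ) (T : List ℤ) (v : ℕ) :
    ((traceTerm [(K, T)] v : ℚ) : ℝ) = ((T.getD v 0 : ℤ) : ℝ) / 4 ^ K := by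
  simp only [traceTerm, add_zero]
  push_cast
  rfl

/-! ## The assembled abstract bound for reduced blocks -/

/-- **Certified lower bound on the objective, reduced-block form.**  Data: objective `cL`,
multipliers `LM` against the shared rows `RW`, factor rows `GB` of the `nb` Gram duals (scale
`4^K`), block entry tables `EB` with own dimensions `dimL` (all `≤ m`), two-level position lists
`P2` (bucket `B`), trace table `T`, residual table `R`, bound `lower`.  Hypotheses on a real `y`:
`y_0 = 1`, `|y_v| ≤ 1`, the equality rows, and EVERY REDUCED BLOCK `redE EB k dimL[k] y ⪰ 0`.
Conclusion: `lower ≤ Σ_v c_v y_v`.  Chain: `gramE_eq_padM`/`posSemidef_padM` (padding),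
`zr_posSemidef` (duals), `sum_trace_zr_mul_fzE` (traces), `objective_bound₂`
(→ `JanssonChaykinKeil.lmiForm_bound`). [folklore] -/
theorem objective_bound_red {nv ne nb m B K : ℕ} (cL : List (ℕ × ℚ)) (LM : List ℚ)
    (RW : List (ℚ × List (ℕ × ℚ))) (GB : List (List (List ℤ)))
    (EB : List (List (List (List (ℕ × ℤ))))) (dimL : List ℕ) (P2 : List (List (List (ℕ × ℕ × ℕ))))
    (T : List ℤ) (R : List ℚ) (lower : ℚ)
    (hLM : LM.length ≤ ne) (hres : ResidOK₂ cL LM RW [(K, T)] R 0 (nv + 1))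
    (hfin : finalCheck₂ LM RW R (nv + 1) lower = true)
    (hlen : lenCheckAll GB m nb = true) (hdim : dimCheck EB dimL m nb = true)
    (hshape : ShapeOK P2 B nb m 0 (nv + 1)) (hcov : EntCoverOK EB P2 B m 0 nb)
    (htr : TraceOK GB EB P2 B T 0 (nv + 1))
    {y : Fin (nv + 1) → ℝ} (hy0 : y 0 = 1) (hρ : ∀ v : Fin (nv + 1), v ≠ 0 → |y v| ≤ 1)
    (heq : ∀ e : Fin ne, ∑ v : Fin (nv + 1),
      ((sget (RW.getD e.val dRow₂).2 v.val : ℚ) : ℝ) * y v = (((RW.getD e.val dRow₂).1 : ℚ) : ℝ))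
    (hpsd : ∀ k : Fin nb, (redE EB k.val (dimL.getD k.val 0) (nv + 1) y).PosSemidef) :
    ((lower : ℚ) : ℝ) ≤ ∑ v : Fin (nv + 1), ((sget cL v.val : ℚ) : ℝ) * y v :=
  objective_bound₂ cL LM RW [(K, T)] R lower hLM hres hfin (K := Fin nb) (σ := fun _ => Fin m)
    (fun k v => (fzE EB k.val m v.val).map (Int.cast : ℤ → ℝ))
    (fun k => zr (GB.getD k.val []) m K) (fun k => zr_posSemidef K (lenCheck_of_all hlen k))
    (fun v => by rw [sum_trace_zr_mul_fzE K hshape hcov htr v, traceTerm_single]) hy0 hρ heq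
    (fun k => posSemidef_gramE_of_redE hdim k.isLt (hpsd k))

end

end Summit.QuantumFields.GaugeBoot.Certificates.Sparse
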